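import Summits.QuantumFields.YangMills.Theorems.UnitScaleTiltProp7Lane2CyclicHats
import HarnessLib

/-!
# Route `UnitScaleTilt`, crux «MinimiserStabilityRegPr» (stmt-QuantumFields-19200), E′ ∕ (N06) LANE II «DIVERGENCE RECOVERY AT CURVED `W`» — brick (B6-a), part 2 of 3:
# THE FAMILY OF CYCLIC SMOOTHSTEP HATS `θ_{c_a}`, `c_a = a·M`, `a < A`, ON `ZMod (A·M)`: IT TILES (`Σ_a θ_{c_a} = 1`), AT MOST TWO HATS ARE ALIVE AT ANY SITE, AND EACH HAT HAS
# STEPS `≤ (3∕2)∕M` AND SECOND DIFFERENCES `≤ 6∕M²`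

Cell `ym3-torus`, width seat `ym3-torus-px11` (gen 6); ★★OWNER RULING №23 (c) + ★p1 g19 LANE II NAMER WORD №1 «(B6) → px11 g6»; LOCATE-B6-POU-px11g6 (fcd9ef01) §1 (P1).
THEOREMS ONLY (0 `def`, 0 `sorry`); `--supports stmt-QuantumFields-19200`, count-neutral.  YM₃ on T³ is a ladder rung (R3), not the Clay problem; nothing here claims (B6),
(V3), `hN06`, a stub, the crux, d = 4 or the mass gap.

Over ✓ `…Lane2CyclicHats` (the hat as a function of the cyclic distance; the distance under `t ↦ t ± 1`; the structure of the centres `a·M`): with `N = A·M`, `A ≥ 2`, `M ≥ 1`,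
* ★★ `sum_hats_eq_one` — `Σ_{a<A} θ_{c_a}(t) = 1` EXACTLY (the two alive hats are `p(r∕M)` and `p(1 − r∕M)`, and `p(v) + p(1−v) = 1`);
* ★ `card_hats_ne_zero_le_two` — at most two indices `a < A` have `θ_{c_a}(t) ≠ 0`;
* `abs_hat_step_le`, ★ `abs_hat_second_le` — for ANY centre `c`: `|θ_c(t±1) − θ_c(t)| ≤ (3∕2)∕M`, `|θ_c(t+1) + θ_c(t−1) − 2θ_c(t)| ≤ 6∕M²`.
The three-dimensional product family on `Site (F.P K) 0` (the (B6) p.o.u. at scale `R`, `M = R·L^{K−n}`) is part 3.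

References: T. Bałaban, CMP 96 (1984) 223–250 [Balaban1984PropagatorsII] ((1.9) p.226); CMP 99 (1985) 389–434 [Balaban1985BackgroundPropagators] ((3.23) p.394).
-/

set_option autoImplicit false

noncomputable section

open scoped BigOperators

namespace Summit.QuantumFields.YangMills.Theorems.Prop7Lane2CyclicHats

open Finset

/-! ## §4 ★★ Consequences: the hats tile, at most two are alive, and their difference rows on the cycle -/

section Family

variable {N A M : ℕ} [NeZero N] (hN : N = A * M) (hA : 2 ≤ A) (hM : 1 ≤ M)
include hN hA hM

omit [NeZero N] in
/-- `1 < N` for `N = A·M`, `A ≥ 2`, `M ≥ 1`. [folklore] -/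
theorem one_lt_N : 1 < N := by
  have : 2 * 1 ≤ A * M := Nat.mul_le_mul hA hM
  omega

omit [NeZero N] hN hM in
/-- The index of the «next» centre differs from `q`. [folklore] -/
theorem succ_mod_ne (q : ℕ) (hq : q < A) : (q + 1) % A ≠ q := by
  rcases Nat.lt_or_ge (q + 1) A with h | h
  · rw [Nat.mod_eq_of_lt h]; omega
  · have : q + 1 = A := le_antisymm hq h
    rw [this, Nat.mod_self]; omega

/-- ★★ **THE HATS TILE THE CYCLE**: `Σ_{a<A} θ_{c_a}(t) = 1` for every `t`. [folklore] -/
theorem sum_hats_eq_one (t : ZMod N) :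
    ∑ a ∈ Finset.range A, (1 - 3 * (max 0 (min (((min (t - ((a * M : ℕ) : ZMod N)).val ((((a * M : ℕ) : ZMod N)) - t).val : ℕ) : ℝ) / M) 1)) ^ 2
        + 2 * (max 0 (min (((min (t - ((a * M : ℕ) : ZMod N)).val ((((a * M : ℕ) : ZMod N)) - t).val : ℕ) : ℝ) / M) 1)) ^ 3) = 1 := by
  have hv := ZMod.val_lt t
  have hM0 : 0 < M := by omega
  obtain ⟨hdq, hdq', hrest⟩ := dist_centres hN hA hM t
  set q := t.val / M with hq
  set r := t.val % M with hr
  have hrM : r < M := Nat.mod_lt _ hM0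
  have hqA : q < A := by
    by_contra h
    have h1 : A * M ≤ q * M := Nat.mul_le_mul_right M (not_lt.mp h)
    have h2 : t.val = q * M + r := by rw [hq, hr, mul_comm]; exact (Nat.div_add_mod _ _).symm
    omega
  have hq'A : (q + 1) % A < A := Nat.mod_lt _ (by omega)
  have hmem : q ∈ Finset.range A := Finset.mem_range.mpr hqA
  have hmem' : (q + 1) % A ∈ (Finset.range A).erase q := Finset.mem_erase.mpr ⟨succ_mod_ne hA q hqA, Finset.mem_range.mpr hq'A⟩
  rw [← Finset.add_sum_erase _ _ hmem, ← Finset.add_sum_erase _ _ hmem', hdq, hdq']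
  rw [Finset.sum_eq_zero, add_zero, hat_add_hat_sub_eq_one hM hrM.le]
  intro a ha
  rw [Finset.mem_erase, Finset.mem_erase, Finset.mem_range] at ha
  exact hat_eq_zero_of_le hM (hrest a ha.2.2 ha.2.1 ha.1)

/-- ★ **AT MOST TWO HATS ARE ALIVE** at any `t`. [folklore] -/
theorem card_hats_ne_zero_le_two (t : ZMod N) :
    ((Finset.range A).filter (fun a => (1 - 3 * (max 0 (min (((min (t - ((a * M : ℕ) : ZMod N)).val ((((a * M : ℕ) : ZMod N)) - t).val : ℕ) : ℝ) / M) 1)) ^ 2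
        + 2 * (max 0 (min (((min (t - ((a * M : ℕ) : ZMod N)).val ((((a * M : ℕ) : ZMod N)) - t).val : ℕ) : ℝ) / M) 1)) ^ 3) ≠ 0)).card ≤ 2 := by
  obtain ⟨-, -, hrest⟩ := dist_centres hN hA hM t
  set q := t.val / M with hq
  have hsub : (Finset.range A).filter (fun a => (1 - 3 * (max 0 (min (((min (t - ((a * M : ℕ) : ZMod N)).val ((((a * M : ℕ) : ZMod N)) - t).val : ℕ) : ℝ) / M) 1)) ^ 2
        + 2 * (max 0 (min (((min (t - ((a * M : ℕ) : ZMod N)).val ((((a * M : ℕ) : ZMod N)) - t).val : ℕ) : ℝ) / M) 1)) ^ 3) ≠ 0)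
      ⊆ {q, (q + 1) % A} := by
    intro a ha
    rw [Finset.mem_filter, Finset.mem_range] at ha
    rw [Finset.mem_insert, Finset.mem_singleton]
    by_contra hne
    push Not at hne
    exact ha.2 (hat_eq_zero_of_le hM (hrest a ha.1 hne.1 hne.2))
  exact (Finset.card_le_card hsub).trans (Finset.card_insert_le _ _ |>.trans (by simp))

variable (c : ZMod N)

/-- **STEP ROWS ON THE CYCLE**: `|θ_c(t+1) − θ_c(t)| ≤ (3∕2)∕M` and `|θ_c(t−1) − θ_c(t)| ≤ (3∕2)∕M`. [folklore] -/
theorem abs_hat_step_le (t : ZMod N) :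
    |(1 - 3 * (max 0 (min (((min (t + 1 - c).val (c - (t + 1)).val : ℕ) : ℝ) / M) 1)) ^ 2 + 2 * (max 0 (min (((min (t + 1 - c).val (c - (t + 1)).val : ℕ) : ℝ) / M) 1)) ^ 3)
        - (1 - 3 * (max 0 (min (((min (t - c).val (c - t).val : ℕ) : ℝ) / M) 1)) ^ 2 + 2 * (max 0 (min (((min (t - c).val (c - t).val : ℕ) : ℝ) / M) 1)) ^ 3)| ≤ 3 / 2 / (M : ℝ) ∧
    |(1 - 3 * (max 0 (min (((min (t - 1 - c).val (c - (t - 1)).val : ℕ) : ℝ) / M) 1)) ^ 2 + 2 * (max 0 (min (((min (t - 1 - c).val (c - (t - 1)).val : ℕ) : ℝ) / M) 1)) ^ 3)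
        - (1 - 3 * (max 0 (min (((min (t - c).val (c - t).val : ℕ) : ℝ) / M) 1)) ^ 2 + 2 * (max 0 (min (((min (t - c).val (c - t).val : ℕ) : ℝ) / M) 1)) ^ 3)| ≤ 3 / 2 / (M : ℝ) := by
  have h1 := one_lt_N hN hA hM
  obtain ⟨hp1, hp2⟩ := dist_add_one_le h1 t c
  obtain ⟨hm1, hm2⟩ := dist_sub_one_le h1 t c
  exact ⟨abs_hat_sub_hat_le hM hp1 hp2, abs_hat_sub_hat_le hM hm1 hm2⟩

/-- ★ **SECOND-DIFFERENCE ROW ON THE CYCLE**: `|θ_c(t+1) + θ_c(t−1) − 2θ_c(t)| ≤ 6∕M²` (`N = A·M ≥ 2M` keeps the alive region away from the antipodal pair). [folklore] -/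
theorem abs_hat_second_le (t : ZMod N) :
    |(1 - 3 * (max 0 (min (((min (t + 1 - c).val (c - (t + 1)).val : ℕ) : ℝ) / M) 1)) ^ 2 + 2 * (max 0 (min (((min (t + 1 - c).val (c - (t + 1)).val : ℕ) : ℝ) / M) 1)) ^ 3)
        + (1 - 3 * (max 0 (min (((min (t - 1 - c).val (c - (t - 1)).val : ℕ) : ℝ) / M) 1)) ^ 2 + 2 * (max 0 (min (((min (t - 1 - c).val (c - (t - 1)).val : ℕ) : ℝ) / M) 1)) ^ 3)
        - 2 * (1 - 3 * (max 0 (min (((min (t - c).val (c - t).val : ℕ) : ℝ) / M) 1)) ^ 2 + 2 * (max 0 (min (((min (t - c).val (c - t).val : ℕ) : ℝ) / M) 1)) ^ 3)|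
      ≤ 6 / (M : ℝ) ^ 2 := by
  have h1 := one_lt_N hN hA hM
  obtain ⟨hp1, hp2⟩ := dist_add_one_le h1 t c
  obtain ⟨hm1, hm2⟩ := dist_sub_one_le h1 t c
  refine abs_hat_second_diff_le hM hp1 hp2 hm1 hm2 ?_
  by_cases h0 : min (t - c).val (c - t).val = 0
  · exact Or.inr (Or.inl h0)
  by_cases hb : M ≤ min (t - c).val (c - t).val
  · exact Or.inr (Or.inr hb)
  left
  have h2M : 2 * M ≤ N := by rw [hN]; exact Nat.mul_le_mul_right M hA
  exact dist_add_one_add_dist_sub_one h1 t c (Nat.pos_of_ne_zero h0) (by omega)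

end Family

end Summit.QuantumFields.YangMills.Theorems.Prop7Lane2CyclicHats

end
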